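import Summits.QuantumFields.YangMills.Theorems.ColdStartUniversalityLatticeLangevinLocalExtension
import HarnessLib

/-!
# The quaternionic-retraction extension with LOCAL Lipschitz data in the WEIGHTED distance `d_w(Q,Q')² = Σ_e w_e ρ(Q_e,Q'_e)²`:
# weighted triangle inequality, comparison with `ρ_L`, weighted dilatation of the retraction under a common shift

Seat `ym-line-csu-p1` (g43), route `ColdStartUniversality` of `Summits/QuantumFields/YangMills`, helper file (`--supports stmt-QuantumFields-24809`).
Weighted twin of G63b (`…LocalExtension`) for a link weight `m ≤ w_e ≤ M`, `0 < m`: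
* `wdist_triangle`, `wdistSq_le_mul`, `mul_le_wdistSq` — `d_w` is a metric with `√m·ρ_L ≤ d_w ≤ √M·ρ_L`;
* ★ `wdistSq_retr_shift_le` — `d_w(π(coords Q − t), π(coords Q' − t))² ≤ ((1/(1−2r))²/(1−u))·d_w(Q,Q')²` (per link: G63b);
* ★★ `ext_shift_sub_le_wlocal`, ★★ `ext_shift_wlocalLipschitz_at` — the common-shift dilatation bound and the local Lipschitz bound at a point
  for `F` that is `G_z`-Lipschitz in `d_w` on ONE `d_w`-ball `{d_w(z,·) ≤ R}`.
THEOREMS ONLY, no definition, no sorry.  HONEST FRAMING: fixed cut-off; nothing `K`-uniform; no crux, rung or summit statement is proved;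
the Yang–Mills mass gap is NOT proved.
-/

set_option autoImplicit false

noncomputable section

namespace Summit.QuantumFields.YangMills.Theorems.ColdStartUniversality

open MeasureTheory ProbabilityTheory Matrix Complex Finset Filter Topology Set Metric
open scoped ComplexConjugate BigOperators Real NNReal Convolution
open Literature.MathematicalPhysics.QuantumFieldTheory
open Literature.MathematicalPhysics.QuantumLattice (fundamentalRep fundamentalLatticeRep continuous_fundamentalRep fundamentalRep_apply fundamentalLatticeRep_N)

variable {L : ℕ} [NeZero L]

/-! ## §1. `d_w` is a metric comparable to `ρ_L` -/

/-- **Triangle inequality for `d_w`** (`w ≥ 0`): Minkowski in `ℓ²(E)` for the vectors `(√w_e ρ(·_e,·_e))_e`. [folklore] -/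
theorem wdist_triangle (U U' U'' : GaugeConfig 3 L (Matrix.specialUnitaryGroup (Fin 2) ℂ)) (w : Edge 3 L → ℝ) (hw : ∀ e, 0 ≤ w e) :
    Real.sqrt (∑ e : Edge 3 L, w e * (fundamentalLatticeRep 2).riemannDist (U e) (U'' e) ^ 2) ≤ Real.sqrt (∑ e : Edge 3 L, w e * (fundamentalLatticeRep 2).riemannDist (U e) (U' e) ^ 2) + Real.sqrt (∑ e : Edge 3 L, w e * (fundamentalLatticeRep 2).riemannDist (U' e) (U'' e) ^ 2) := by
  classical
  set x : EuclideanSpace ℝ (Edge 3 L) := WithLp.toLp 2 (fun e => Real.sqrt (w e) * (fundamentalLatticeRep 2).riemannDist (U e) (U' e)) with hx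
  set y : EuclideanSpace ℝ (Edge 3 L) := WithLp.toLp 2 (fun e => Real.sqrt (w e) * (fundamentalLatticeRep 2).riemannDist (U' e) (U'' e)) with hy
  have hsq : ∀ e, Real.sqrt (w e) ^ 2 = w e := fun e => Real.sq_sqrt (hw e)
  have hnx : ‖x‖ = Real.sqrt (∑ e : Edge 3 L, w e * (fundamentalLatticeRep 2).riemannDist (U e) (U' e) ^ 2) := by
    rw [EuclideanSpace.norm_eq]; congr 1; refine Finset.sum_congr rfl fun e _ => ?_
    rw [hx, PiLp.toLp_apply, Real.norm_eq_abs, sq_abs, mul_pow, hsq]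
  have hny : ‖y‖ = Real.sqrt (∑ e : Edge 3 L, w e * (fundamentalLatticeRep 2).riemannDist (U' e) (U'' e) ^ 2) := by
    rw [EuclideanSpace.norm_eq]; congr 1; refine Finset.sum_congr rfl fun e _ => ?_
    rw [hy, PiLp.toLp_apply, Real.norm_eq_abs, sq_abs, mul_pow, hsq]
  have hnxy : Real.sqrt (∑ e : Edge 3 L, w e * (fundamentalLatticeRep 2).riemannDist (U e) (U'' e) ^ 2) ≤ ‖x + y‖ := by
    rw [EuclideanSpace.norm_eq]
    refine Real.sqrt_le_sqrt (Finset.sum_le_sum fun e _ => ?_)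
    rw [Real.norm_eq_abs, sq_abs]
    have h0 := (fundamentalLatticeRep 2).riemannDist_nonneg (U e) (U'' e)
    have htri := riemannDist_two_triangle (U e) (U' e) (U'' e)
    have hsum : (x + y) e = Real.sqrt (w e) * (fundamentalLatticeRep 2).riemannDist (U e) (U' e) + Real.sqrt (w e) * (fundamentalLatticeRep 2).riemannDist (U' e) (U'' e) := by
      rw [hx, hy]; rfl
    replace hsum : (x + y) e = Real.sqrt (w e) * ((fundamentalLatticeRep 2).riemannDist (U e) (U' e) + (fundamentalLatticeRep 2).riemannDist (U' e) (U'' e)) := by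
      rw [hsum]; ring
    rw [hsum, mul_pow, hsq]
    exact mul_le_mul_of_nonneg_left (pow_le_pow_left₀ h0 htri 2) (hw e)
  calc Real.sqrt (∑ e : Edge 3 L, w e * (fundamentalLatticeRep 2).riemannDist (U e) (U'' e) ^ 2) ≤ ‖x + y‖ := hnxy
    _ ≤ ‖x‖ + ‖y‖ := norm_add_le x y
    _ = Real.sqrt (∑ e : Edge 3 L, w e * (fundamentalLatticeRep 2).riemannDist (U e) (U' e) ^ 2) + Real.sqrt (∑ e : Edge 3 L, w e * (fundamentalLatticeRep 2).riemannDist (U' e) (U'' e) ^ 2) := by rw [hnx, hny]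

/-- `d_w² ≤ M·ρ_L²` for `w ≤ M`. [folklore] -/
theorem wdistSq_le_mul (U U' : GaugeConfig 3 L (Matrix.specialUnitaryGroup (Fin 2) ℂ)) (w : Edge 3 L → ℝ) {M : ℝ} (hwM : ∀ e, w e ≤ M) :
    (∑ e : Edge 3 L, w e * (fundamentalLatticeRep 2).riemannDist (U e) (U' e) ^ 2) ≤ M * torusRiemannDistSq (fundamentalLatticeRep 2) (U) (U') := by
  unfold torusRiemannDistSq; rw [Finset.mul_sum]
  exact Finset.sum_le_sum fun e _ => mul_le_mul_of_nonneg_right (hwM e) (sq_nonneg _)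

/-- `m·ρ_L² ≤ d_w²` for `m ≤ w`. [folklore] -/
theorem mul_le_wdistSq (U U' : GaugeConfig 3 L (Matrix.specialUnitaryGroup (Fin 2) ℂ)) (w : Edge 3 L → ℝ) {m : ℝ} (hwm : ∀ e, m ≤ w e) :
    m * torusRiemannDistSq (fundamentalLatticeRep 2) (U) (U') ≤ (∑ e : Edge 3 L, w e * (fundamentalLatticeRep 2).riemannDist (U e) (U' e) ^ 2) := by
  unfold torusRiemannDistSq; rw [Finset.mul_sum]
  exact Finset.sum_le_sum fun e _ => mul_le_mul_of_nonneg_right (hwm e) (sq_nonneg _)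

/-- `d_w ≤ √M·ρ_L`. [folklore] -/
theorem wdist_le_sqrt_mul (U U' : GaugeConfig 3 L (Matrix.specialUnitaryGroup (Fin 2) ℂ)) (w : Edge 3 L → ℝ) {M : ℝ} (hwM : ∀ e, w e ≤ M) :
    Real.sqrt (∑ e : Edge 3 L, w e * (fundamentalLatticeRep 2).riemannDist (U e) (U' e) ^ 2) ≤ Real.sqrt M * Real.sqrt (torusRiemannDistSq (fundamentalLatticeRep 2) (U) (U')) := by
  rw [← Real.sqrt_mul' _ (by unfold torusRiemannDistSq; exact Finset.sum_nonneg fun _ _ => sq_nonneg _)]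
  exact Real.sqrt_le_sqrt (wdistSq_le_mul U U' w hwM)

/-! ## §2. The weighted dilatation of the retraction under a common shift -/

/-- ★ **Weighted dilatation of the retraction under a common shift**: for `w ≥ 0`, `‖t‖_∞ ≤ r ≤ 1/4`, `u < 1` and
`(1/(1−2r))²·ρ_L(Q,Q')² ≤ 8u`:  `d_w(π(coords Q − t), π(coords Q' − t))² ≤ ((1/(1−2r))²/(1 − u))·d_w(Q,Q')²` (per link exactly as in G63b).
[cite: GallotHulinLafontaine2004, 2.91] -/
theorem wdistSq_retr_shift_le (Q Q' : GaugeConfig 3 L (Matrix.specialUnitaryGroup (Fin 2) ℂ)) (t : Edge 3 L × Fin 2 × Fin 2 × Bool → ℝ) {r u : ℝ} (hr : r ≤ 1 / 4) (hu : u < 1)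
    (w : Edge 3 L → ℝ) (hw : ∀ e, 0 ≤ w e) :
    let coords : GaugeConfig 3 L (Matrix.specialUnitaryGroup (Fin 2) ℂ) → (Edge 3 L × Fin 2 × Fin 2 × Bool → ℝ) :=
      fun V q => (fun z : ℂ => if q.2.2.2 then z.im else z.re) ((fundamentalRep (Fin 2) (V q.1) : Matrix (Fin 2) (Fin 2) ℂ) q.2.1 q.2.2.1)
    let rebuild : (Edge 3 L × Fin 2 × Fin 2 × Bool → ℝ) → Edge 3 L → Matrix (Fin 2) (Fin 2) ℂ :=
      fun x e => Matrix.of fun i j : Fin 2 => ((x (e, i, j, false) : ℝ) : ℂ) + ((x (e, i, j, true) : ℝ) : ℂ) * Complex.I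
    let qP : Matrix (Fin 2) (Fin 2) ℂ → Matrix (Fin 2) (Fin 2) ℂ := fun M =>
      !![(M 0 0 + conj (M 1 1)) / 2, (M 0 1 - conj (M 1 0)) / 2; -conj ((M 0 1 - conj (M 1 0)) / 2), conj ((M 0 0 + conj (M 1 1)) / 2)]
    let retr : (Edge 3 L × Fin 2 × Fin 2 × Bool → ℝ) → GaugeConfig 3 L (Matrix.specialUnitaryGroup (Fin 2) ℂ) := fun x e =>
      if h : hsForm 2 (qP (rebuild x e)) (qP (rebuild x e)) ≠ 0 then
        ⟨(Real.sqrt 2 / Real.sqrt (hsForm 2 (qP (rebuild x e)) (qP (rebuild x e)))) • qP (rebuild x e),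
          normalize_quatProj_mem_specialUnitaryGroup_two (rebuild x e) h⟩
      else 1
    ‖t‖ ≤ r → (1 / (1 - 2 * r)) ^ 2 * torusRiemannDistSq (fundamentalLatticeRep 2) Q Q' ≤ 8 * u →
      (∑ e : Edge 3 L, w e * (fundamentalLatticeRep 2).riemannDist (retr (coords Q - t) e) (retr (coords Q' - t) e) ^ 2) ≤
        (1 / (1 - 2 * r)) ^ 2 / (1 - u) * (∑ e : Edge 3 L, w e * (fundamentalLatticeRep 2).riemannDist (Q e) (Q' e) ^ 2) := by
  intro coords rebuild qP retr ht hsmall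
  set lam2 : ℝ := (1 / (1 - 2 * r)) ^ 2 with hlam2
  have hlam0 : 0 ≤ lam2 := sq_nonneg _
  have h1u : 0 < 1 - u := by linarith
  have hce : ∀ e, hsForm 2 ((Q' e : Matrix (Fin 2) (Fin 2) ℂ) - (Q e : Matrix (Fin 2) (Fin 2) ℂ)) ((Q' e : Matrix (Fin 2) (Fin 2) ℂ) - (Q e : Matrix (Fin 2) (Fin 2) ℂ)) ≤ torusRiemannDistSq (fundamentalLatticeRep 2) Q Q' := fun e =>
    (Finset.single_le_sum (f := fun e' : Edge 3 L => hsForm 2 ((Q' e' : Matrix (Fin 2) (Fin 2) ℂ) - (Q e' : Matrix (Fin 2) (Fin 2) ℂ)) ((Q' e' : Matrix (Fin 2) (Fin 2) ℂ) - (Q e' : Matrix (Fin 2) (Fin 2) ℂ))) (fun _ _ => hsForm_self_nonneg _) (Finset.mem_univ e)).trans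
      (sum_hsForm_sub_le_torusRiemannDistSq_two Q Q')
  have hcρ : ∀ e, hsForm 2 ((Q' e : Matrix (Fin 2) (Fin 2) ℂ) - (Q e : Matrix (Fin 2) (Fin 2) ℂ)) ((Q' e : Matrix (Fin 2) (Fin 2) ℂ) - (Q e : Matrix (Fin 2) (Fin 2) ℂ)) ≤ (fundamentalLatticeRep 2).riemannDist (Q e) (Q' e) ^ 2 := fun e => by
    have h0 := hsForm_self_nonneg (N := 2) ((Q' e : Matrix (Fin 2) (Fin 2) ℂ) - (Q e : Matrix (Fin 2) (Fin 2) ℂ))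
    have h := sqrt_hsForm_sub_le_riemannDist_two (Q e) (Q' e)
    calc hsForm 2 ((Q' e : Matrix (Fin 2) (Fin 2) ℂ) - (Q e : Matrix (Fin 2) (Fin 2) ℂ)) ((Q' e : Matrix (Fin 2) (Fin 2) ℂ) - (Q e : Matrix (Fin 2) (Fin 2) ℂ)) = Real.sqrt (hsForm 2 ((Q' e : Matrix (Fin 2) (Fin 2) ℂ) - (Q e : Matrix (Fin 2) (Fin 2) ℂ)) ((Q' e : Matrix (Fin 2) (Fin 2) ℂ) - (Q e : Matrix (Fin 2) (Fin 2) ℂ))) ^ 2 := (Real.sq_sqrt h0).symm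
      _ ≤ (fundamentalLatticeRep 2).riemannDist (Q e) (Q' e) ^ 2 := pow_le_pow_left₀ (Real.sqrt_nonneg _) h 2
  have hedge : ∀ e, (fundamentalLatticeRep 2).riemannDist (retr (coords Q - t) e) (retr (coords Q' - t) e) ^ 2 ≤ lam2 / (1 - u) * hsForm 2 ((Q' e : Matrix (Fin 2) (Fin 2) ℂ) - (Q e : Matrix (Fin 2) (Fin 2) ℂ)) ((Q' e : Matrix (Fin 2) (Fin 2) ℂ) - (Q e : Matrix (Fin 2) (Fin 2) ℂ)) := by
    intro e
    set c2 : ℝ := hsForm 2 ((Q' e : Matrix (Fin 2) (Fin 2) ℂ) - (Q e : Matrix (Fin 2) (Fin 2) ℂ)) ((Q' e : Matrix (Fin 2) (Fin 2) ℂ) - (Q e : Matrix (Fin 2) (Fin 2) ℂ)) with hc2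
    set d2 : ℝ := hsForm 2 (((retr (coords Q' - t) e : Matrix.specialUnitaryGroup (Fin 2) ℂ) : Matrix (Fin 2) (Fin 2) ℂ) - ((retr (coords Q - t) e : Matrix.specialUnitaryGroup (Fin 2) ℂ) : Matrix (Fin 2) (Fin 2) ℂ))
      (((retr (coords Q' - t) e : Matrix.specialUnitaryGroup (Fin 2) ℂ) : Matrix (Fin 2) (Fin 2) ℂ) - ((retr (coords Q - t) e : Matrix.specialUnitaryGroup (Fin 2) ℂ) : Matrix (Fin 2) (Fin 2) ℂ)) with hd2
    have hc0 : 0 ≤ c2 := hsForm_self_nonneg _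
    have hd0 : 0 ≤ d2 := hsForm_self_nonneg _
    have hdc : d2 ≤ lam2 * c2 := hsForm_retr_shift_sub_le Q Q' t hr e ht
    have hd8 : d2 ≤ 8 * u := hdc.trans ((mul_le_mul_of_nonneg_left (hce e) hlam0).trans hsmall)
    have hd8' : d2 < 8 := by linarith
    have hρ := riemannDist_two_le_chord_div_sqrt (retr (coords Q - t) e) (retr (coords Q' - t) e) hd8'
    have hρ0 : 0 ≤ (fundamentalLatticeRep 2).riemannDist (retr (coords Q - t) e) (retr (coords Q' - t) e) := (fundamentalLatticeRep 2).riemannDist_nonneg _ _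
    have hden : 0 < 1 - d2 / 8 := by linarith
    calc (fundamentalLatticeRep 2).riemannDist (retr (coords Q - t) e) (retr (coords Q' - t) e) ^ 2 ≤ (Real.sqrt d2 / Real.sqrt (1 - d2 / 8)) ^ 2 :=
          pow_le_pow_left₀ hρ0 hρ 2
      _ = d2 / (1 - d2 / 8) := by rw [div_pow, Real.sq_sqrt hd0, Real.sq_sqrt hden.le]
      _ ≤ d2 / (1 - u) := div_le_div_of_nonneg_left hd0 h1u (by linarith)
      _ ≤ lam2 * c2 / (1 - u) := div_le_div_of_nonneg_right hdc h1u.le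
      _ = lam2 / (1 - u) * c2 := by ring
  calc (∑ e : Edge 3 L, w e * (fundamentalLatticeRep 2).riemannDist (retr (coords Q - t) e) (retr (coords Q' - t) e) ^ 2)
      ≤ ∑ e : Edge 3 L, w e * (lam2 / (1 - u) * (fundamentalLatticeRep 2).riemannDist (Q e) (Q' e) ^ 2) :=
        Finset.sum_le_sum fun e _ => mul_le_mul_of_nonneg_left ((hedge e).trans (mul_le_mul_of_nonneg_left (hcρ e) (div_nonneg hlam0 h1u.le))) (hw e)
    _ = lam2 / (1 - u) * (∑ e : Edge 3 L, w e * (fundamentalLatticeRep 2).riemannDist (Q e) (Q' e) ^ 2) := by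
        rw [Finset.mul_sum]; exact Finset.sum_congr rfl fun e _ => by ring

/-! ## §3. The common-shift dilatation and the local Lipschitz bound, weighted -/

/-- ★★ **Common-shift dilatation with a LOCAL `d_w`-Lipschitz hypothesis.**  Let `0 ≤ w ≤ M` and let `F` be `G_z`-Lipschitz for `d_w` on the ball
`{d_w(z,·) ≤ R}`.  For `‖t‖_∞ ≤ r ≤ 1/4`, `u < 1`, `d_w(z,Q') + √M·12√#E·r ≤ R` and `(1/(1−2r))²·ρ_L(z,Q')² ≤ 8u`:
`|F̃(coords Q' − t) − F̃(coords z − t)| ≤ G_z·((1/(1−2r))/√(1−u))·d_w(z,Q')`. [cite: ShenZhuZhu2022, §4.1] -/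
theorem ext_shift_sub_le_wlocal (F : GaugeConfig 3 L (Matrix.specialUnitaryGroup (Fin 2) ℂ) → ℝ) (z : GaugeConfig 3 L (Matrix.specialUnitaryGroup (Fin 2) ℂ)) (w : Edge 3 L → ℝ) (hw : ∀ e, 0 ≤ w e) {M : ℝ} (hwM : ∀ e, w e ≤ M)
    {R Gz : ℝ} (hGz : 0 ≤ Gz)
    (hlipR : ∀ z' z'' : GaugeConfig 3 L (Matrix.specialUnitaryGroup (Fin 2) ℂ), Real.sqrt (∑ e : Edge 3 L, w e * (fundamentalLatticeRep 2).riemannDist (z e) (z' e) ^ 2) ≤ R → Real.sqrt (∑ e : Edge 3 L, w e * (fundamentalLatticeRep 2).riemannDist (z e) (z'' e) ^ 2) ≤ R → |F z'' - F z'| ≤ Gz * Real.sqrt (∑ e : Edge 3 L, w e * (fundamentalLatticeRep 2).riemannDist (z' e) (z'' e) ^ 2))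
    (Q' : GaugeConfig 3 L (Matrix.specialUnitaryGroup (Fin 2) ℂ)) (t : Edge 3 L × Fin 2 × Fin 2 × Bool → ℝ) {r u : ℝ} (hr : r ≤ 1 / 4) (hu : u < 1) :
    let coords : GaugeConfig 3 L (Matrix.specialUnitaryGroup (Fin 2) ℂ) → (Edge 3 L × Fin 2 × Fin 2 × Bool → ℝ) :=
      fun V q => (fun z : ℂ => if q.2.2.2 then z.im else z.re) ((fundamentalRep (Fin 2) (V q.1) : Matrix (Fin 2) (Fin 2) ℂ) q.2.1 q.2.2.1)
    let rebuild : (Edge 3 L × Fin 2 × Fin 2 × Bool → ℝ) → Edge 3 L → Matrix (Fin 2) (Fin 2) ℂ :=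
      fun x e => Matrix.of fun i j : Fin 2 => ((x (e, i, j, false) : ℝ) : ℂ) + ((x (e, i, j, true) : ℝ) : ℂ) * Complex.I
    let qP : Matrix (Fin 2) (Fin 2) ℂ → Matrix (Fin 2) (Fin 2) ℂ := fun M =>
      !![(M 0 0 + conj (M 1 1)) / 2, (M 0 1 - conj (M 1 0)) / 2; -conj ((M 0 1 - conj (M 1 0)) / 2), conj ((M 0 0 + conj (M 1 1)) / 2)]
    let retr : (Edge 3 L × Fin 2 × Fin 2 × Bool → ℝ) → GaugeConfig 3 L (Matrix.specialUnitaryGroup (Fin 2) ℂ) := fun x e =>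
      if h : hsForm 2 (qP (rebuild x e)) (qP (rebuild x e)) ≠ 0 then
        ⟨(Real.sqrt 2 / Real.sqrt (hsForm 2 (qP (rebuild x e)) (qP (rebuild x e)))) • qP (rebuild x e),
          normalize_quatProj_mem_specialUnitaryGroup_two (rebuild x e) h⟩
      else 1
    let cut : (Edge 3 L × Fin 2 × Fin 2 × Bool → ℝ) → ℝ := fun x =>
      ∏ e : Edge 3 L, Real.smoothTransition (8 * hsForm 2 (qP (rebuild x e)) (qP (rebuild x e)) - 1)
    ‖t‖ ≤ r → Real.sqrt (∑ e : Edge 3 L, w e * (fundamentalLatticeRep 2).riemannDist (z e) (Q' e) ^ 2) + Real.sqrt M * (12 * Real.sqrt (Fintype.card (Edge 3 L)) * r) ≤ R →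
      (1 / (1 - 2 * r)) ^ 2 * torusRiemannDistSq (fundamentalLatticeRep 2) z Q' ≤ 8 * u →
      |cut (coords Q' - t) * F (retr (coords Q' - t)) - cut (coords z - t) * F (retr (coords z - t))| ≤
        Gz * ((1 / (1 - 2 * r)) / Real.sqrt (1 - u)) * Real.sqrt (∑ e : Edge 3 L, w e * (fundamentalLatticeRep 2).riemannDist (z e) (Q' e) ^ 2) := by
  intro coords rebuild qP retr cut ht hR hsmall
  have hx : ‖coords z - t - coords z‖ ≤ r := by rw [sub_sub_cancel_left, norm_neg]; exact ht
  have hx' : ‖coords Q' - t - coords Q'‖ ≤ r := by rw [sub_sub_cancel_left, norm_neg]; exact ht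
  have hcut : cut (coords z - t) = 1 := (retr_near z (coords z - t) (hx.trans hr)).2.1
  have hcut' : cut (coords Q' - t) = 1 := (retr_near Q' (coords Q' - t) (hx'.trans hr)).2.1
  have hM0 : 0 ≤ Real.sqrt M := Real.sqrt_nonneg _
  -- both retracted points are in the ball
  have hin : Real.sqrt (∑ e : Edge 3 L, w e * (fundamentalLatticeRep 2).riemannDist (z e) (retr (coords z - t) e) ^ 2) ≤ R := by
    have h1 : Real.sqrt (torusRiemannDistSq (fundamentalLatticeRep 2) (z) (retr (coords z - t))) ≤ 12 * Real.sqrt (Fintype.card (Edge 3 L)) * r := riemannDist_retr_le z (coords z - t) hr hx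
    have h2 := wdist_le_sqrt_mul z (retr (coords z - t)) w hwM
    have h3 : Real.sqrt M * Real.sqrt (torusRiemannDistSq (fundamentalLatticeRep 2) (z) (retr (coords z - t))) ≤ Real.sqrt M * (12 * Real.sqrt (Fintype.card (Edge 3 L)) * r) := mul_le_mul_of_nonneg_left h1 hM0
    have h4 : 0 ≤ Real.sqrt (∑ e : Edge 3 L, w e * (fundamentalLatticeRep 2).riemannDist (z e) (Q' e) ^ 2) := Real.sqrt_nonneg _
    linarith
  have hin' : Real.sqrt (∑ e : Edge 3 L, w e * (fundamentalLatticeRep 2).riemannDist (z e) (retr (coords Q' - t) e) ^ 2) ≤ R := by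
    have h1 : Real.sqrt (torusRiemannDistSq (fundamentalLatticeRep 2) (Q') (retr (coords Q' - t))) ≤ 12 * Real.sqrt (Fintype.card (Edge 3 L)) * r := riemannDist_retr_le Q' (coords Q' - t) hr hx'
    have h2 := wdist_le_sqrt_mul Q' (retr (coords Q' - t)) w hwM
    have h3 : Real.sqrt M * Real.sqrt (torusRiemannDistSq (fundamentalLatticeRep 2) (Q') (retr (coords Q' - t))) ≤ Real.sqrt M * (12 * Real.sqrt (Fintype.card (Edge 3 L)) * r) := mul_le_mul_of_nonneg_left h1 hM0
    have h4 := wdist_triangle z Q' (retr (coords Q' - t)) w hw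
    linarith
  have hT := wdistSq_retr_shift_le z Q' t hr hu w hw ht hsmall
  have h1u : 0 ≤ 1 - u := by linarith
  have hlam : 0 ≤ 1 / (1 - 2 * r) := div_nonneg zero_le_one (by linarith)
  rw [hcut, hcut', one_mul, one_mul]
  calc |F (retr (coords Q' - t)) - F (retr (coords z - t))|
      ≤ Gz * Real.sqrt (∑ e : Edge 3 L, w e * (fundamentalLatticeRep 2).riemannDist (retr (coords z - t) e) (retr (coords Q' - t) e) ^ 2) := hlipR _ _ hin hin'
    _ ≤ Gz * Real.sqrt ((1 / (1 - 2 * r)) ^ 2 / (1 - u) * (∑ e : Edge 3 L, w e * (fundamentalLatticeRep 2).riemannDist (z e) (Q' e) ^ 2)) := mul_le_mul_of_nonneg_left (Real.sqrt_le_sqrt hT) hGz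
    _ = Gz * ((1 / (1 - 2 * r)) / Real.sqrt (1 - u)) * Real.sqrt (∑ e : Edge 3 L, w e * (fundamentalLatticeRep 2).riemannDist (z e) (Q' e) ^ 2) := by
        rw [Real.sqrt_mul (div_nonneg (sq_nonneg _) h1u), Real.sqrt_div (sq_nonneg _), Real.sqrt_sq hlam]; ring

/-- ★★ **Local `d_w`-Lipschitz bound at a point along common shifts.**  Under the hypotheses of `ext_shift_sub_le_wlocal` with `0 < m ≤ w ≤ M` and
`√M·12√#E·r < R`: for every `η > 0` there is `δ > 0` such that `|F̃(coords Q' − t) − F̃(coords z − t)| ≤ (G_z/(1−2r) + η)·d_w(z,Q')` for all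
`‖t‖_∞ ≤ r` and `d_w(z,Q') < δ`. [cite: ShenZhuZhu2022, §4.1] -/
theorem ext_shift_wlocalLipschitz_at (F : GaugeConfig 3 L (Matrix.specialUnitaryGroup (Fin 2) ℂ) → ℝ) (z : GaugeConfig 3 L (Matrix.specialUnitaryGroup (Fin 2) ℂ)) (w : Edge 3 L → ℝ) {m M : ℝ} (hm : 0 < m) (hwm : ∀ e, m ≤ w e)
    (hwM : ∀ e, w e ≤ M) {R Gz : ℝ} (hGz : 0 ≤ Gz)
    (hlipR : ∀ z' z'' : GaugeConfig 3 L (Matrix.specialUnitaryGroup (Fin 2) ℂ), Real.sqrt (∑ e : Edge 3 L, w e * (fundamentalLatticeRep 2).riemannDist (z e) (z' e) ^ 2) ≤ R → Real.sqrt (∑ e : Edge 3 L, w e * (fundamentalLatticeRep 2).riemannDist (z e) (z'' e) ^ 2) ≤ R → |F z'' - F z'| ≤ Gz * Real.sqrt (∑ e : Edge 3 L, w e * (fundamentalLatticeRep 2).riemannDist (z' e) (z'' e) ^ 2))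
    {r : ℝ} (hr : r ≤ 1 / 4) (hrR : Real.sqrt M * (12 * Real.sqrt (Fintype.card (Edge 3 L)) * r) < R) {η : ℝ} (hη : 0 < η) :
    let coords : GaugeConfig 3 L (Matrix.specialUnitaryGroup (Fin 2) ℂ) → (Edge 3 L × Fin 2 × Fin 2 × Bool → ℝ) :=
      fun V q => (fun z : ℂ => if q.2.2.2 then z.im else z.re) ((fundamentalRep (Fin 2) (V q.1) : Matrix (Fin 2) (Fin 2) ℂ) q.2.1 q.2.2.1)
    let rebuild : (Edge 3 L × Fin 2 × Fin 2 × Bool → ℝ) → Edge 3 L → Matrix (Fin 2) (Fin 2) ℂ :=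
      fun x e => Matrix.of fun i j : Fin 2 => ((x (e, i, j, false) : ℝ) : ℂ) + ((x (e, i, j, true) : ℝ) : ℂ) * Complex.I
    let qP : Matrix (Fin 2) (Fin 2) ℂ → Matrix (Fin 2) (Fin 2) ℂ := fun M =>
      !![(M 0 0 + conj (M 1 1)) / 2, (M 0 1 - conj (M 1 0)) / 2; -conj ((M 0 1 - conj (M 1 0)) / 2), conj ((M 0 0 + conj (M 1 1)) / 2)]
    let retr : (Edge 3 L × Fin 2 × Fin 2 × Bool → ℝ) → GaugeConfig 3 L (Matrix.specialUnitaryGroup (Fin 2) ℂ) := fun x e =>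
      if h : hsForm 2 (qP (rebuild x e)) (qP (rebuild x e)) ≠ 0 then
        ⟨(Real.sqrt 2 / Real.sqrt (hsForm 2 (qP (rebuild x e)) (qP (rebuild x e)))) • qP (rebuild x e),
          normalize_quatProj_mem_specialUnitaryGroup_two (rebuild x e) h⟩
      else 1
    let cut : (Edge 3 L × Fin 2 × Fin 2 × Bool → ℝ) → ℝ := fun x =>
      ∏ e : Edge 3 L, Real.smoothTransition (8 * hsForm 2 (qP (rebuild x e)) (qP (rebuild x e)) - 1)
    ∃ δ > 0, ∀ t : Edge 3 L × Fin 2 × Fin 2 × Bool → ℝ, ‖t‖ ≤ r → ∀ Q' : GaugeConfig 3 L (Matrix.specialUnitaryGroup (Fin 2) ℂ), Real.sqrt (∑ e : Edge 3 L, w e * (fundamentalLatticeRep 2).riemannDist (z e) (Q' e) ^ 2) < δ →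
      |cut (coords Q' - t) * F (retr (coords Q' - t)) - cut (coords z - t) * F (retr (coords z - t))| ≤
        (Gz / (1 - 2 * r) + η) * Real.sqrt (∑ e : Edge 3 L, w e * (fundamentalLatticeRep 2).riemannDist (z e) (Q' e) ^ 2) := by
  intro coords rebuild qP retr cut
  have hw : ∀ e, 0 ≤ w e := fun e => hm.le.trans (hwm e)
  set lam : ℝ := 1 / (1 - 2 * r) with hlamdef
  have h12 : 0 < 1 - 2 * r := by linarith
  have hlam : 0 < lam := div_pos one_pos h12
  set C : ℝ := Gz / (1 - 2 * r) with hCdef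
  have hC : C = Gz * lam := div_eq_mul_one_div _ _
  have hC0 : 0 ≤ C := div_nonneg hGz h12.le
  set u : ℝ := min (1 / 2) (η / (C + 1)) with hudef
  have hu0 : 0 < u := lt_min (by norm_num) (div_pos hη (by linarith))
  have hu2 : u ≤ 1 / 2 := min_le_left _ _
  have huη : u ≤ η / (C + 1) := min_le_right _ _
  have hu1 : u < 1 := by linarith
  set gap : ℝ := R - Real.sqrt M * (12 * Real.sqrt (Fintype.card (Edge 3 L)) * r) with hgap
  have hgap0 : 0 < gap := by rw [hgap]; linarith
  -- `δ = min(√(8um)/λ, gap)`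
  refine ⟨min (Real.sqrt (8 * u * m) / lam) gap, lt_min (div_pos (Real.sqrt_pos.2 (by positivity)) hlam) hgap0, fun t ht Q' hQ => ?_⟩
  have hQ1 : Real.sqrt (∑ e : Edge 3 L, w e * (fundamentalLatticeRep 2).riemannDist (z e) (Q' e) ^ 2) < Real.sqrt (8 * u * m) / lam := lt_of_lt_of_le hQ (min_le_left _ _)
  have hQ2 : Real.sqrt (∑ e : Edge 3 L, w e * (fundamentalLatticeRep 2).riemannDist (z e) (Q' e) ^ 2) < gap := lt_of_lt_of_le hQ (min_le_right _ _)
  set D : ℝ := Real.sqrt (∑ e : Edge 3 L, w e * (fundamentalLatticeRep 2).riemannDist (z e) (Q' e) ^ 2) with hDdef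
  have hD0 : 0 ≤ D := Real.sqrt_nonneg _
  have hDsq : D ^ 2 = (∑ e : Edge 3 L, w e * (fundamentalLatticeRep 2).riemannDist (z e) (Q' e) ^ 2) := Real.sq_sqrt (Finset.sum_nonneg fun e _ => mul_nonneg (hw e) (sq_nonneg _))
  have hsmall : (1 / (1 - 2 * r)) ^ 2 * torusRiemannDistSq (fundamentalLatticeRep 2) z Q' ≤ 8 * u := by
    have h1 : lam * D < Real.sqrt (8 * u * m) := by rw [mul_comm]; exact (lt_div_iff₀ hlam).1 hQ1
    have h2 : (lam * D) ^ 2 < Real.sqrt (8 * u * m) ^ 2 := pow_lt_pow_left₀ h1 (mul_nonneg hlam.le hD0) two_ne_zero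
    rw [Real.sq_sqrt (by positivity), mul_pow, hDsq] at h2
    have h3 := mul_le_wdistSq z Q' w hwm
    have h4 : lam ^ 2 * (m * torusRiemannDistSq (fundamentalLatticeRep 2) z Q') ≤ lam ^ 2 * (∑ e : Edge 3 L, w e * (fundamentalLatticeRep 2).riemannDist (z e) (Q' e) ^ 2) :=
      mul_le_mul_of_nonneg_left h3 (sq_nonneg _)
    have h5 : m * (lam ^ 2 * torusRiemannDistSq (fundamentalLatticeRep 2) z Q') < m * (8 * u) := by nlinarith
    exact (lt_of_mul_lt_mul_left h5 hm.le).le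
  have hRle : D + Real.sqrt M * (12 * Real.sqrt (Fintype.card (Edge 3 L)) * r) ≤ R := by rw [hgap] at hQ2; linarith
  have hmain : |cut (coords Q' - t) * F (retr (coords Q' - t)) - cut (coords z - t) * F (retr (coords z - t))| ≤ Gz * (lam / Real.sqrt (1 - u)) * D :=
    ext_shift_sub_le_wlocal F z w hw hwM hGz hlipR Q' t hr hu1 ht hRle hsmall
  refine hmain.trans (mul_le_mul_of_nonneg_right ?_ hD0)
  have h1u : 0 < 1 - u := by linarith
  have hK : 1 / Real.sqrt (1 - u) ≤ 1 + u := by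
    rw [div_le_iff₀ (Real.sqrt_pos.2 h1u)]
    have hsq : (1 + u) * Real.sqrt (1 - u) = Real.sqrt ((1 + u) ^ 2 * (1 - u)) := by
      rw [Real.sqrt_mul (sq_nonneg _), Real.sqrt_sq (by linarith)]
    rw [hsq]
    refine Real.one_le_sqrt.2 ?_
    have hpoly : 0 ≤ u * (1 - u - u ^ 2) := mul_nonneg hu0.le (by nlinarith)
    nlinarith
  have hCu : C * u ≤ η := by
    have h1 : C * u ≤ (C + 1) * u := by nlinarith
    have h2 : (C + 1) * u ≤ η := by
      have := (le_div_iff₀ (by linarith : (0 : ℝ) < C + 1)).1 huη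
      linarith
    linarith
  calc Gz * (lam / Real.sqrt (1 - u)) = C * (1 / Real.sqrt (1 - u)) := by rw [hC]; ring
    _ ≤ C * (1 + u) := mul_le_mul_of_nonneg_left hK hC0
    _ = C + C * u := by ring
    _ ≤ C + η := by linarith

end Summit.QuantumFields.YangMills.Theorems.ColdStartUniversality
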